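import Summits.AtomisticToContinuum.HydrodynamicLimit.Theorems.CollisionActivityTails.Negative.Kinematics

/-!
# Negative knowledge for the crux `CollisionActivityTails` — the quantifier SHAPE

From the standing disprover's `Cruxes/CollisionActivityTails/Disproof.lean` §3 (cycle 1) and §7
(cycle 2; refuter-cdisprove-stmt-AtomisticToContinuum-13734; crux stmt-AtomisticToContinuum-13734,
shared by routes TwoClocks and OneFlightGossipEngine).  Nothing here asserts the crux; every
statement is about ABSTRACT families of laws on `ℝ` and is closed (sorry-free).

Since the threshold `V` is quantified BEFORE the accuracy `ε`, the crux
(`collisionActivityTails_iff_cruxShape`) has the shape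
`CruxShape E := ∃ V₀ > 0 ∀ V ≥ V₀ ∀ ε > 0 ∃ τ₀ ∀ τ ≥ τ₀ ∃ N₀ ∀ N ≥ N₀, E V τ N ≤ ε` for the tail
functional `E V τ N = sup_{s ≤ t} E_{λ_N}[(N+1)⁻¹ Σᵢ 𝟙{V < aᵢ} aᵢ]`: ASYMPTOTIC ESSENTIAL BOUNDEDNESS
of the window activity, not uniform integrability (`UIShape`: `∀ ε ∃ V …`).  Everything the
functional sees of the laws is the mixture law on `ℝ` of the activity of a uniformly chosen
particle, so the separating families below are families of laws `ν τ N` on `ℝ`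
(`lawTail`, `lawFrac`, `lawMean`).

* `CruxShape.uiShape`, `CruxShape.fracShape` — crux shape ⇒ UI shape, crux shape ⇒ crux-shaped
  FRACTION statement (`P(a > V) → 0` for `V ≥ V₀`, Chebyshev at the threshold).
* `cruxShape_iff_uiShape_and_fracShape` — for law functionals the crux shape is EXACTLY
  "UI shape ∧ crux-shaped fraction statement" (`𝟙{V<y} y ≤ 𝟙{K<y} y + K 𝟙{V<y}` and
  `V 𝟙{V<y} ≤ 𝟙{V<y} y`).  This is the abstract form of the split used by line `SketchK1`
  (cycle 2: `CrowdedCollisionTails ⇐ CrowdedActivityUI ∧ CrowdedFractionLLN`, and the near-field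
  analogue through `KineticEnergyTails`): the split loses nothing and eases nothing — both halves
  are load-bearing (the two families of the companion file `ShapeWitnesses.lean` separate them)
  and together they are the tail statement.
* `crux_iff_cruxShape` (deprecated alias `collisionActivityTails_iff_cruxShape`) — the crux is
  literally of crux shape.

The separating witnesses live in `Negative/ShapeWitnesses.lean` (size split):
* `exists_meanBounded_fracShape_not_uiShape` — the SPIKE family (activity `N+1` on a fraction
  `(N+1)⁻¹` of the particles, `0` elsewhere) has mean activity `1`, satisfies the crux-shaped
  FRACTION statement (`P(a > V) → 0`), and fails UI (hence the crux shape): a bound on the MEAN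
  activity — all that pressure / virial / extensive-impulse (Serre-type) information can give —
  and even the vanishing of the hyperactive FRACTION imply nothing about the activity-weighted tail.
* `exists_uiShape_moments_not_fracShape` — the GEOMETRIC law (fixed, integrable, every moment
  finite, unbounded support) has the UI shape and all moments bounded uniformly, yet fails the
  crux-shaped fraction statement and the crux shape: NO estimate `sup E[aᵢ^p] ≤ C_p` and not even
  uniform integrability can prove the crux; a proof must produce one-sided CONCENTRATION of the
  tagged activity (a law of large numbers in the window length).

2026-08-17 repair (route TwoClocks rev 10 removed its copy `Theses.TwoClocks.CollisionActivityTails` of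
the crux decl; importer rebuild after p133541 repaired `Negative/Kinematics.lean` the same way): the one
statement naming the crux, §3, is restated verbatim against the byte-identical OneFlightGossipEngine
decl `Theses.OneFlightGossipEngine.CollisionActivityTails` (stmt-AtomisticToContinuum-13734 unchanged)
under the new name `crux_iff_cruxShape` (same proof, through `collisionActivityTails_iff_activityTail`);
the landed name `collisionActivityTails_iff_cruxShape` is kept as a deprecated alias of it (append-only:
deprecate, don't mutate — the pattern of the sibling repairs `Negative/Kinematics.lean`,
`Negative/EquilibriumReduction.lean`).  No other declaration changed.
-/

noncomputable section

open MeasureTheory Filter Set Topology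
open scoped ENNReal

namespace Summit.AtomisticToContinuum.HydrodynamicLimit.Theorems

namespace CollisionActivityTailsShape

open Literature.MathematicalPhysics.KineticTheory Literature.Analysis.FluidPDE
open CollisionActivityTailsNegative

/-! ## §1 The shapes -/

/-- The quantifier shape of the crux over an abstract functional `E V τ N`
(in the crux: `E V τ N = sup_{s ≤ t} E_{λ_N}[activityTail N V (a(s))]`, all other data frozen). -/
def CruxShape (E : ℝ → ℝ → ℕ → ℝ≥0∞) : Prop :=
  ∃ V₀ : ℝ, 0 < V₀ ∧ ∀ V : ℝ, V₀ ≤ V → ∀ ε : ℝ, 0 < ε → ∃ τ₀ : ℝ, 0 < τ₀ ∧ ∀ τ : ℝ, τ₀ ≤ τ →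
    ∃ N₀ : ℕ, ∀ N : ℕ, N₀ ≤ N → E V τ N ≤ ENNReal.ofReal ε

/-- The uniform-integrability shape: the threshold may depend on the accuracy. -/
def UIShape (E : ℝ → ℝ → ℕ → ℝ≥0∞) : Prop :=
  ∀ ε : ℝ, 0 < ε → ∃ V : ℝ, ∃ τ₀ : ℝ, 0 < τ₀ ∧ ∀ τ : ℝ, τ₀ ≤ τ →
    ∃ N₀ : ℕ, ∀ N : ℕ, N₀ ≤ N → E V τ N ≤ ENNReal.ofReal ε

/-- The crux shape implies the UI shape (take `V = V₀`). -/
theorem CruxShape.uiShape {E : ℝ → ℝ → ℕ → ℝ≥0∞} (h : CruxShape E) : UIShape E := by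
  obtain ⟨V₀, -, h⟩ := h
  exact fun ε hε => ⟨V₀, h V₀ le_rfl ε hε⟩

/-- The tail functional `E_μ[𝟙{V < y} y]` of a law `μ` on `ℝ`. -/
def lawTail (μ : Measure ℝ) (V : ℝ) : ℝ≥0∞ := ∫⁻ y, ENNReal.ofReal (tailFn V y) ∂μ

/-- The fraction functional `μ{V < y}` of a law `μ` on `ℝ` (as an integral of an indicator). -/
def lawFrac (μ : Measure ℝ) (V : ℝ) : ℝ≥0∞ := ∫⁻ y, Set.indicator {y : ℝ | V < y} (fun _ => (1 : ℝ≥0∞)) y ∂μ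

/-- The mean `E_μ[y⁺]` of a law on `ℝ`. -/
def lawMean (μ : Measure ℝ) : ℝ≥0∞ := ∫⁻ y, ENNReal.ofReal y ∂μ

/-- The fraction functional is the measure of the super-level set. -/
theorem lawFrac_eq (μ : Measure ℝ) (V : ℝ) : lawFrac μ V = μ {y : ℝ | V < y} :=
  lintegral_indicator_one (measurableSet_lt measurable_const measurable_id)

/-- At the origin the tail functional vanishes whatever the threshold. -/
theorem tailFn_at_zero (V : ℝ) : tailFn V 0 = 0 := by
  by_cases h : V < 0
  · exact tailFn_of_lt h
  · exact tailFn_of_le (not_lt.1 h)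

/-- The tail functional is antitone in the threshold, in `ℝ≥0∞` (nonnegative arguments or not:
below a nonpositive threshold the value `y ≤ 0` is sent to `0` by `ENNReal.ofReal`). -/
theorem ofReal_tailFn_anti {K K' : ℝ} (hKK' : K ≤ K') (y : ℝ) :
    ENNReal.ofReal (tailFn K' y) ≤ ENNReal.ofReal (tailFn K y) := by
  by_cases h : K' < y
  · rw [tailFn_of_lt h, tailFn_of_lt (hKK'.trans_lt h)]
  · rw [tailFn_of_le (not_lt.1 h), ENNReal.ofReal_zero]
    exact bot_le

/-- The law tail is antitone in the threshold. -/
theorem lawTail_anti (μ : Measure ℝ) {K K' : ℝ} (hKK' : K ≤ K') : lawTail μ K' ≤ lawTail μ K :=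
  lintegral_mono fun y => ofReal_tailFn_anti hKK' y

/-- **Chebyshev at the threshold**: `V · μ{V < y} ≤ E_μ[𝟙{V < y} y]`. -/
theorem ofReal_mul_lawFrac_le (μ : Measure ℝ) (V : ℝ) :
    ENNReal.ofReal V * lawFrac μ V ≤ lawTail μ V := by
  rw [lawFrac, ← lintegral_const_mul' _ _ ENNReal.ofReal_ne_top]
  refine lintegral_mono fun y => ?_
  by_cases h : V < y
  · rw [Set.indicator_of_mem (show y ∈ {y : ℝ | V < y} from h), mul_one, tailFn_of_lt h]
    exact ENNReal.ofReal_le_ofReal h.le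
  · rw [Set.indicator_of_notMem (show y ∉ {y : ℝ | V < y} from h), mul_zero]
    exact bot_le

/-- **Truncation**: `E_μ[𝟙{V < y} y] ≤ E_μ[𝟙{K < y} y] + K⁺ · μ{V < y}` (any `K`; `ENNReal.ofReal`
clips a negative `K` to `0`). -/
theorem lawTail_le_add (μ : Measure ℝ) (V K : ℝ) :
    lawTail μ V ≤ lawTail μ K + ENNReal.ofReal K * lawFrac μ V := by
  rw [lawTail, lawTail, lawFrac, ← lintegral_const_mul' _ _ ENNReal.ofReal_ne_top,
    ← lintegral_add_left ((measurable_tailFn K).ennreal_ofReal)]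
  refine lintegral_mono fun y => ?_
  by_cases hV : V < y
  · rw [tailFn_of_lt hV, Set.indicator_of_mem (show y ∈ {y : ℝ | V < y} from hV), mul_one]
    by_cases hKy : K < y
    · rw [tailFn_of_lt hKy]
      exact le_self_add
    · rw [tailFn_of_le (not_lt.1 hKy), ENNReal.ofReal_zero, zero_add]
      exact ENNReal.ofReal_le_ofReal (not_lt.1 hKy)
  · rw [tailFn_of_le (not_lt.1 hV), ENNReal.ofReal_zero]
    exact bot_le

/-! ## §2 Crux shape = UI shape ∧ crux-shaped fraction statement (law functionals) -/

/-- The crux shape implies the crux-shaped FRACTION statement `P(a > V) → 0` (`V ≥ V₀`). -/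
theorem CruxShape.fracShape {ν : ℝ → ℕ → Measure ℝ}
    (h : CruxShape fun V τ N => lawTail (ν τ N) V) : CruxShape fun V τ N => lawFrac (ν τ N) V := by
  obtain ⟨V₀, hV₀, h⟩ := h
  refine ⟨V₀, hV₀, fun V hV ε hε => ?_⟩
  have hVpos : 0 < V := hV₀.trans_le hV
  obtain ⟨τ₀, hτ₀, h⟩ := h V hV (V * ε) (mul_pos hVpos hε)
  refine ⟨τ₀, hτ₀, fun τ hτ => ?_⟩
  obtain ⟨N₀, h⟩ := h τ hτ
  refine ⟨N₀, fun N hN => ?_⟩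
  have key : ENNReal.ofReal V * lawFrac (ν τ N) V ≤ ENNReal.ofReal V * ENNReal.ofReal ε := by
    rw [← ENNReal.ofReal_mul hVpos.le]
    exact (ofReal_mul_lawFrac_le _ V).trans (h N hN)
  exact (ENNReal.mul_le_mul_iff_right (ENNReal.ofReal_pos.2 hVpos).ne' ENNReal.ofReal_ne_top).1 key

/-- **UI shape ∧ fraction statement ⇒ crux shape** (the split of line `SketchK1`, cycle 2, in the
abstract): truncate at the UI level `K`, then kill `K · P(a > V)` with the fraction statement. -/
theorem cruxShape_of_uiShape_of_fracShape {ν : ℝ → ℕ → Measure ℝ}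
    (hUI : UIShape fun V τ N => lawTail (ν τ N) V)
    (hF : CruxShape fun V τ N => lawFrac (ν τ N) V) :
    CruxShape fun V τ N => lawTail (ν τ N) V := by
  obtain ⟨V₀, hV₀, hF⟩ := hF
  refine ⟨V₀, hV₀, fun V hV ε hε => ?_⟩
  obtain ⟨K, τa, hτa, hK⟩ := hUI (ε / 2) (half_pos hε)
  set K' : ℝ := max K 1 with hK'
  have hK'pos : 0 < K' := lt_of_lt_of_le one_pos (le_max_right _ _)
  obtain ⟨τb, hτb, hb⟩ := hF V hV (ε / 2 / K') (div_pos (half_pos hε) hK'pos)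
  refine ⟨max τa τb, lt_max_of_lt_left hτa, fun τ hτ => ?_⟩
  obtain ⟨Na, hNa⟩ := hK τ ((le_max_left _ _).trans hτ)
  obtain ⟨Nb, hNb⟩ := hb τ ((le_max_right _ _).trans hτ)
  refine ⟨max Na Nb, fun N hN => ?_⟩
  have h1 : lawTail (ν τ N) K' ≤ ENNReal.ofReal (ε / 2) :=
    (lawTail_anti _ (le_max_left K 1)).trans (hNa N ((le_max_left _ _).trans hN))
  have h2 : lawFrac (ν τ N) V ≤ ENNReal.ofReal (ε / 2 / K') := hNb N ((le_max_right _ _).trans hN)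
  calc lawTail (ν τ N) V ≤ lawTail (ν τ N) K' + ENNReal.ofReal K' * lawFrac (ν τ N) V :=
        lawTail_le_add _ V K'
    _ ≤ ENNReal.ofReal (ε / 2) + ENNReal.ofReal K' * ENNReal.ofReal (ε / 2 / K') :=
        add_le_add h1 (mul_le_mul_right h2 _)
    _ = ENNReal.ofReal ε := by
        rw [← ENNReal.ofReal_mul hK'pos.le, mul_div_cancel₀ _ hK'pos.ne',
          ← ENNReal.ofReal_add (half_pos hε).le (half_pos hε).le, add_halves]

/-- **The crux shape is exactly UI shape ∧ crux-shaped fraction statement.** -/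
theorem cruxShape_iff_uiShape_and_fracShape (ν : ℝ → ℕ → Measure ℝ) :
    CruxShape (fun V τ N => lawTail (ν τ N) V) ↔
      UIShape (fun V τ N => lawTail (ν τ N) V) ∧ CruxShape fun V τ N => lawFrac (ν τ N) V :=
  ⟨fun h => ⟨h.uiShape, h.fracShape⟩, fun h => cruxShape_of_uiShape_of_fracShape h.1 h.2⟩

/-! ## §3 The crux IS of crux shape (so §2 and the witnesses of `ShapeWitnesses.lean` apply to it verbatim) -/

/-- `CollisionActivityTails` (stmt-AtomisticToContinuum-13734, decl of route OneFlightGossipEngine) is, data by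
data, the statement `CruxShape E` for the tail functional
`E V τ N = sup_{s ∈ [0,t]} E_{λ_N}[activityTail N V (a(s))]`. -/
theorem crux_iff_cruxShape :
    Summit.AtomisticToContinuum.HydrodynamicLimit.Theses.OneFlightGossipEngine.CollisionActivityTails ↔
    ∀ (a₀ θ₀ : T3 → ℝ) (u₀ : T3 → V3), Continuous a₀ → Continuous θ₀ → Continuous u₀ →
      (∀ x, 0 < a₀ x) → (∀ x, 0 < θ₀ x) → ∃ σ₀ : ℝ, 0 < σ₀ ∧ ∀ σ : ℝ, 0 < σ → σ < σ₀ →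
      ∀ (T : ℝ) (ρ θ : ℝ → T3 → ℝ) (u : ℝ → T3 → V3), IsHardSphereEulerSolution σ T ρ u θ →
      ∀ Φ : (N : ℕ) → Flow σ N,
      TendstoHydroFieldsAt (fun N => localGibbsLaw σ a₀ u₀ θ₀ N (Φ N)) Φ ρ u θ 0 →
      ∀ t ∈ Set.Ico 0 T,
        CruxShape fun V τ N => ⨆ s ∈ Set.Icc 0 t,
          ∫⁻ z, ENNReal.ofReal (activityTail N V
            (fun i => activity (Φ N) τ (Set.Ioc s (s + window τ N)) i z))
          ∂(localGibbsLaw σ a₀ u₀ θ₀ N (Φ N)) := by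
  simp only [collisionActivityTails_iff_activityTail, CruxShape, iSup₂_le_iff]

/-- Former name of `crux_iff_cruxShape`, stated through the TwoClocks copy of the crux
(`Theses.TwoClocks.CollisionActivityTails`, removed by route TwoClocks rev 10 on 2026-08-16); the
statement of stmt-13734 is unchanged and is now read from route OneFlightGossipEngine. -/
@[deprecated crux_iff_cruxShape (since := "2026-08-17")]
alias collisionActivityTails_iff_cruxShape := crux_iff_cruxShape

end CollisionActivityTailsShape

end Summit.AtomisticToContinuum.HydrodynamicLimit.Theorems

end
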